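import Literature.AlgebraicGeometry.Motives.GrassmannianQuotientIsoPullback
import Literature.AlgebraicGeometry.Modules.EpiOfSameRankIsIso
import HarnessLib

/-!
# A rank-`k` quotient of `𝒪_T ⊗ M` whose sectionwise kernels CONTAIN the point `f` is classified by `f`
# (the «point of the universal family» engine of Mumford's Lect. 15 step (III))

Topic `AlgebraicGeometry/Motives`; namespace `Literature.AlgebraicGeometry.Motives.Grassmannian`.  THEOREMS ONLY (no definition,
no instance, no notation, no named fact, no `sorry`).  Cell `hodgecm-mathlib` (D-0151), F-5 (5d) step (III-Gr) (B-plan1 (g17)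
09:09:40Z; census `B-provers/B-p03/g18/CENSUS-5d-IIIGr.B-p03g18.md` (L-iv)); count-neutral Mathlib-side capital.  HC_CM is proved only
modulo the 7 printed citations until rung 0 closes; nothing here is about HC.

For `f : T ⟶ Grass_k(M)` and an epimorphism `φ : 𝒪_T^{(J)} = 𝒪_T ⊗ M ↠ N` onto a module of rank `k`: if on every affine open `V ⊆ T`
the submodule `(pointsEquiv f)|_V ⊆ Γ(T, V) ⊗ M` (the point `f`, i.e. the kernel of `𝒪_T ⊗ M ↠ f^*𝒬`) is CONTAINED in the kernel of the
sections map `θ_V(N, φ ε)` — «the equations of `f` die in `N`» — then it EQUALS that kernel, i.e. `f` is the classifying morphism of `(N, φ)`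
(★ `existsUnique_hom_of_epi_freeModule`'s property) and `N ≅ f^*𝒬` under `𝒪_T^{(J)}`.  Reason: `φ` factors through `𝒪_T^{(J)} ↠ f^*𝒬`
(★ `exists_comp_eq_of_app`), the factor is an epimorphism between locally free modules of the SAME rank `k`, hence an isomorphism (★
`isIso_of_epi_of_hasRank`).  This is the step «`K ⊆ K′` with equal coranks ⇒ `K = K′`» of [Mumford1966CurvesSurface] Lect. 15 (III)
(the `Gr`-point of the universal family `Z_{g^*𝒦}` over the flattening stratum is `g` itself), isolated from the projective model.

* `app_eq_zero_of_evalAffine_le_ker` — the containment hypothesis in sectionwise form: `ψ_V x = 0 ⟹ φ_V x = 0` for the quotient map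
  `ψ : 𝒪_T^{(J)} ↠ f^*𝒬`;
* **`exists_iso_pullback_universalQuotient_of_evalAffine_le_ker`** — `∃ e : f^*𝒬 ≅ N, ψ ≫ e.hom = φ`;
* **`forall_evalAffine_eq_ker_of_evalAffine_le_ker`** — `∀ V, (pointsEquiv f)|_V = ker θ_V(N, φ ε)` (containment ⇒ equality);
* `eq_of_evalAffine_le_ker` — hence any `g` classifying `(N, φ)` equals `f`.

## References
* [Mumford1966CurvesSurface] D. Mumford, *Lectures on Curves on an Algebraic Surface* (1966), Lecture 15 (III)–(V) (pp. 105–108).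
* [GortzWedhorn2020] U. Görtz, T. Wedhorn, *Algebraic Geometry I* (2nd ed., 2020), (8.4) (pp. 213–215).
* [Hartshorne1977] R. Hartshorne, *Algebraic Geometry* (1977), II §5 (p. 109), II Prop. 5.6 (p. 113).
* [StacksProject] Tag 089R.
-/

noncomputable section
-- `TopCat.Presheaf`/`Scheme.Modules` are not reducible (as in Mathlib's `AlgebraicGeometry/Modules/Tilde.lean`).
set_option backward.isDefEq.respectTransparency false

open CategoryTheory Opposite TensorProduct TopologicalSpace AlgebraicGeometry Limits
open Literature.AlgebraicGeometry.Motives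

universe u

namespace Literature.AlgebraicGeometry.Motives.Grassmannian

open Literature.AlgebraicGeometry.Modules

variable (k : ℕ) (M : Type u) [AddCommGroup M] {J : Type u} [Fintype J] (b : Module.Basis J ℤ M)
  [(grassmannianSheaf M k).obj.IsRepresentable] {T : Scheme.{u}} (f : T ⟶ grassmannianScheme M k)
  {N : T.Modules} (φ : freeModule T J ⟶ N)
  (hle : ∀ V : T.affineOpens, (evalAffine V.2 (pointsEquiv M k T f)).toSubmodule ≤
    LinearMap.ker (sectionsMap b N (fun j => φ.app ⊤ (freeSectionOn T j ⊤)) V))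

include hle in
/-- **The containment in sectionwise form**: if `(pointsEquiv f)|_V ⊆ ker θ_V(N, φ ε)` on affine opens, then for the quotient map
`ψ : 𝒪_T^{(J)} ↠ f^*𝒬` (any morphism with `ker θ_V(f^*𝒬, ψ ε) = (pointsEquiv f)|_V`, ★ `ker_sectionsMap_pullback_universalQuotient`) one has
`ψ_V x = 0 ⟹ φ_V x = 0` on every affine `V` (★ `sectionsMap_app_freeSectionOn_eq`, ★ `sectionsMap_freeModule_surjective`).
[cite: GortzWedhorn2020, (8.4) (pp. 213–215)] [cite: Hartshorne1977, II §5 (p. 109)] -/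
theorem app_eq_zero_of_evalAffine_le_ker {Q : T.Modules} (ψ : freeModule T J ⟶ Q)
    (hψ : ∀ V : T.affineOpens, LinearMap.ker (sectionsMap b Q (fun j => ψ.app ⊤ (freeSectionOn T j ⊤)) V) =
      (evalAffine V.2 (pointsEquiv M k T f)).toSubmodule)
    (V : T.Opens) (hV : IsAffineOpen V) (x : Γ(freeModule T J, V)) (hx : ψ.app V x = 0) : φ.app V x = 0 := by
  obtain ⟨z, rfl⟩ := sectionsMap_freeModule_surjective b V x
  rw [← sectionsMap_app_freeSectionOn_eq] at hx ⊢
  have hz : z ∈ (evalAffine hV (pointsEquiv M k T f)).toSubmodule := by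
    rw [← hψ ⟨V, hV⟩]; exact hx
  exact hle ⟨V, hV⟩ hz

include hle in
/-- **`N ≅ f^*𝒬` UNDER `𝒪_T^{(J)}` when the point `f` dies in the rank-`k` quotient `N`**: the quotient map `ψ : 𝒪_T^{(J)} ↠ f^*𝒬`
(★ `exists_epi_freeModule_pullback_universalQuotient`) and an isomorphism `e : f^*𝒬 ≅ N` with `ψ ≫ e.hom = φ` — `φ` factors through `ψ`
(★ `exists_comp_eq_of_app`), and the factor is an epimorphism between rank-`k` locally free modules, hence an isomorphism (★
`isIso_of_epi_of_hasRank`). [cite: Mumford1966CurvesSurface, Lecture 15 (III) (pp. 105–108)] [cite: Hartshorne1977, II Prop. 5.6 (p. 113)] -/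
theorem exists_iso_pullback_universalQuotient_of_evalAffine_le_ker [Epi φ] (hN : HasRank N k) :
    ∃ (ψ : freeModule T J ⟶ (Scheme.Modules.pullback f).obj (universalQuotient k M b))
      (e : (Scheme.Modules.pullback f).obj (universalQuotient k M b) ≅ N),
      (∀ (j : J) (V : T.Opens), ψ.app V (freeSectionOn T j V) =
        ((Scheme.Modules.pullback f).obj (universalQuotient k M b)).presheaf.map (homOfLE (le_top : V ≤ ⊤)).op
          (unitSection f (universalQuotient k M b) ⊤ (universalQuotientSection k M b j))) ∧
      Epi ψ ∧ ψ ≫ e.hom = φ := by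
  obtain ⟨ψ, hψ, hepi⟩ := exists_epi_freeModule_pullback_universalQuotient k M b f
  have hψtop : (fun j => ψ.app ⊤ (freeSectionOn T j ⊤)) =
      fun j => unitSection f (universalQuotient k M b) ⊤ (universalQuotientSection k M b j) := by
    funext j
    rw [hψ j ⊤, show homOfLE (le_top : (⊤ : T.Opens) ≤ ⊤) = 𝟙 _ from Subsingleton.elim _ _, op_id,
      ((Scheme.Modules.pullback f).obj (universalQuotient k M b)).presheaf.map_id]
    rfl
  have hker : ∀ V : T.affineOpens, LinearMap.ker (sectionsMap b _ (fun j => ψ.app ⊤ (freeSectionOn T j ⊤)) V) =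
      (evalAffine V.2 (pointsEquiv M k T f)).toSubmodule := fun V => by
    rw [hψtop]; exact ker_sectionsMap_pullback_universalQuotient k M b f V.2
  haveI := hepi
  obtain ⟨e, he⟩ := exists_comp_eq_of_app ψ φ fun V hV x hx =>
    app_eq_zero_of_evalAffine_le_ker k M b f φ hle ψ hker V hV x hx
  haveI : Epi e := epi_of_epi_fac he
  haveI : IsIso e := isIso_of_epi_of_hasRank e (hasRank_pullback_universalQuotient k M b f) hN
  exact ⟨ψ, asIso e, hψ, hepi, he⟩

include hle in
/-- **CONTAINMENT ⇒ EQUALITY: `(pointsEquiv f)|_V = ker θ_V(N, φ ε)` on every affine open** — so `f` IS the classifying morphism of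
the rank-`k` quotient `(N, φ)` (★ `existsUnique_hom_of_epi_freeModule`'s defining property).  From the isomorphism `f^*𝒬 ≅ N` under
`𝒪_T^{(J)}`: `φ_V x = 0 ↔ ψ_V x = 0`, and `ker θ_V(f^*𝒬, ψ ε) = (pointsEquiv f)|_V` (★ `ker_sectionsMap_pullback_universalQuotient`).
[cite: Mumford1966CurvesSurface, Lecture 15 (III) (pp. 105–108)] [cite: GortzWedhorn2020, (8.4) (pp. 213–215)] [cite: StacksProject, Tag 089R] -/
theorem forall_evalAffine_eq_ker_of_evalAffine_le_ker [Epi φ] (hN : HasRank N k) :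
    ∀ V : T.affineOpens, (evalAffine V.2 (pointsEquiv M k T f)).toSubmodule =
      LinearMap.ker (sectionsMap b N (fun j => φ.app ⊤ (freeSectionOn T j ⊤)) V) := by
  obtain ⟨ψ, e, hψ, hepi, he⟩ := exists_iso_pullback_universalQuotient_of_evalAffine_le_ker k M b f φ hle hN
  have hψtop : (fun j => ψ.app ⊤ (freeSectionOn T j ⊤)) =
      fun j => unitSection f (universalQuotient k M b) ⊤ (universalQuotientSection k M b j) := by
    funext j
    rw [hψ j ⊤, show homOfLE (le_top : (⊤ : T.Opens) ≤ ⊤) = 𝟙 _ from Subsingleton.elim _ _, op_id,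
      ((Scheme.Modules.pullback f).obj (universalQuotient k M b)).presheaf.map_id]
    rfl
  intro V
  rw [← ker_sectionsMap_pullback_universalQuotient k M b f V.2, ← hψtop]
  ext z
  rw [LinearMap.mem_ker, LinearMap.mem_ker, sectionsMap_app_freeSectionOn_eq, sectionsMap_app_freeSectionOn_eq, ← he,
    Scheme.Modules.Hom.comp_app, CategoryTheory.comp_apply]
  constructor
  · intro h; rw [h, map_zero]
  · intro h
    have := congrArg (e.inv.app V) h
    rwa [map_zero, ← CategoryTheory.comp_apply, ← Scheme.Modules.Hom.comp_app, e.hom_inv_id, Scheme.Modules.Hom.id_app] at this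

include hle in
/-- **Hence any morphism classifying `(N, φ)` equals `f`.** [cite: GortzWedhorn2020, (8.4) (pp. 213–215)] -/
theorem eq_of_evalAffine_le_ker [Epi φ] (hN : HasRank N k) {g : T ⟶ grassmannianScheme M k}
    (hg : ∀ V : T.affineOpens, (evalAffine V.2 (pointsEquiv M k T g)).toSubmodule =
      LinearMap.ker (sectionsMap b N (fun j => φ.app ⊤ (freeSectionOn T j ⊤)) V)) : g = f :=
  hom_ext_of_evalAffine M k fun V hV => Module.Grassmannian.ext
    ((hg ⟨V, hV⟩).trans (forall_evalAffine_eq_ker_of_evalAffine_le_ker k M b f φ hle hN ⟨V, hV⟩).symm)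

end Literature.AlgebraicGeometry.Motives.Grassmannian

end
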